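/-
Copyright (c) 2026. All rights reserved.
Released under Apache 2.0 license as described in the file LICENSE.
-/
import Summits.HodgeConjecture.HodgeConjecture.Theorems.K2LiuArchKFiniteContinuation   -- ★ asm FILE 9 p862044 (`kFinite_continuation`)
import Mathlib.MeasureTheory.Integral.Pi                                               -- `integral_fintype_prod_volume_eq_prod`
import HarnessLib

/-!
# Crux `HLiu418`, G6-arch ASSEMBLY FILE 10 — (E8) MULTI-PLACE, IN THE FRAME'S COORDINATES: the archimedean block
# `∫ ∏_w F_w((0 B_w; C_w 0) · n(b_w) · g_w) d b` over `∏_w Herm₂(ℂ)` is `∏_w ‖det C_w‖⁻⁴ · M_w F_w (m_w g_w)`, hence HOLOMORPHIC ON `{0 < re s}`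
# for flat families (odd weights) — the letter `hA` of ★ `exists_bigCell_continuation_cm_of_faces` modulo the record's chart

Cell `hodgecm-mathlib`, crux item hLiu418 = `stmt-HodgeConjecture-24832` (helper lane `--supports`, count-neutral).  LEAD BATCH #53 (2): «(E8) multi-place product asm → K2Liu-p11».

THE FRAME'S COORDINATES (all ★): at a complex place `w` the tube frame ★ `K2LiuHermitianTubeFrameArch.exists_tubeFrame_arch` ∕ ★ `K2LiuHolTubeRigidityOfFrame` (`Fr_w`)
carries `H(L⁺_w) → U(J)`, `N_Δ ↠ {n(b) = (1 b; 0 1), bᴴ = b}`, and `w_Δ ↦ x_w = T_w·diag(1,−1)·T_w⁻¹ = (0 B_w; C_w 0) ∈ U(J)` (★ `frame_archPart_weylDelta`, ★ `K2LiuHermitianTubeFrameWeyl`).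
For such an ANTI-DIAGONAL `x = (0 B; C 0) ∈ U(J)`: `Cᴴ B = −1`, `(−B)ᴴ C = 1`, `x = J · m`, `m = diag(C, −B) ∈ U(J) ∩ P`, and `m · n(b) = n(C b Cᴴ) · m`; so for ANY integrand `F`,
`∫_{Herm₂} F(x · n(b) · g) db = ‖det C‖⁻⁴ · ∫_{Herm₂} F(J · n(b) · (m g)) db = ‖det C‖⁻⁴ · M_w F (m g)` (★ `integral_comp_hermTwo_conj`, ★ `integral_hermOfReal_eq`) — and ★ FILE 9
`kFinite_continuation` at the point `m g ∈ U(J)` makes it a holomorphic function of `s` on `{0 < re}` for every flat family with compact picture `Q` (odd `k`).  Over finitely many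
complex places the block is the product (Mathlib `integral_fintype_prod_volume_eq_prod`), holomorphic as a finite product (★ (H1) `differentiableOn_finset_prod`).
* §1 `antidiag_letters`, `antidiag_eq_J_mul_levi`, `levi_mul_transl`; §2 **`integral_antidiag_transl`**; §3 **`archBlock_continuation`** (one place);
* §4 **`archBlock_prod_continuation`** — `σ` a finite set of places, data `k Q B C g : σ → …` with `(0 B_w; C_w 0), g_w ∈ U(J)`, `k_w` odd:
  `∃ E` holomorphic on `{0<re}`, `∀ s, ½ < re s → ∀ F : σ → (U(J)-sections), (∀ w, F_w ∈ I_w(s,χ_{k_w}) ∧ cp F_w = Q_w) → ∫ ∏_w F_w(x_w·n(b_w)·g_w) db = E(s)`.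
WHAT REMAINS for p13's `hA` after this file: only the record's bookkeeping — `ν_∞` on `N_Δ(L⁺⊗ℝ)` as the image of `∏_w` Lebesgue under the frames (one Haar constant), and the
presentation of the arch component of the `T`-block as such a product `∏_w F_w ∘ Fr_w` ((E6)).
References: [Shimura1997, §§5–6, §16.4]; [Shimura1982, (1.31)]; [KudlaRallis1994, §1]; [Tan1999, §3].
HONEST LABEL: HC_CM is proved only modulo the 7 printed citations (2 remaining named inputs: hLiu418 = stmt-HodgeConjecture-24832,
h413 = stmt-HodgeConjecture-24833) until rung 0 closes; count-neutral helper, closes no socket.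
-/

set_option autoImplicit false
set_option linter.dupNamespace false

noncomputable section

open Complex Matrix MeasureTheory
open scoped ComplexConjugate ComplexOrder

namespace Summit.HodgeConjecture.HodgeConjecture.Cruxes.HLiu418.K2LiuArchBlockOfFrame

open Summit.HodgeConjecture.HodgeConjecture.Cruxes.HLiu418.K2LiuHermTwoGammaDefs (hermTwo)
open Summit.HodgeConjecture.HodgeConjecture.Cruxes.HLiu418.K2LiuHermitianTubeCocycle (mul_mem_UJ J_mem)
open Summit.HodgeConjecture.HodgeConjecture.Cruxes.HLiu418.K2LiuArchInducedTubeDefs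
open Summit.HodgeConjecture.HodgeConjecture.Cruxes.HLiu418.K2LiuU22CompactPictureDefs
open Summit.HodgeConjecture.HodgeConjecture.Cruxes.HLiu418.K2LiuArchWhittakerLeviEquivariance (integral_comp_hermTwo_conj levi_mem)
open Summit.HodgeConjecture.HodgeConjecture.Cruxes.HLiu418.K2LiuArchIntertwiningScalarValue (integral_hermOfReal_eq)
open Summit.HodgeConjecture.HodgeConjecture.Cruxes.HLiu418.K2LiuLadderIntertwinerScalars (differentiableOn_finset_prod)
open Summit.HodgeConjecture.HodgeConjecture.Cruxes.HLiu418.K2LiuArchKFiniteContinuation (kFinite_continuation)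

/-! ## §1  Anti-diagonal elements of `U(J)` -/

/-- for `x = (0 B; C 0) ∈ U(J)`: `Cᴴ B = −1` and `(−B)ᴴ C = 1` (block reading of `xᴴ J x = J`). [Shimura1997, §5] -/
theorem antidiag_letters {B C : Matrix (Fin 2) (Fin 2) ℂ} (hx : (fromBlocks 0 B C 0 : Matrix (Fin 2 ⊕ Fin 2) (Fin 2 ⊕ Fin 2) ℂ)ᴴ * Matrix.J (Fin 2) ℂ * (fromBlocks 0 B C 0 : Matrix (Fin 2 ⊕ Fin 2) (Fin 2 ⊕ Fin 2) ℂ) = Matrix.J (Fin 2) ℂ) :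
    Cᴴ * B = -1 ∧ (-B)ᴴ * C = 1 := by
  have hJ : Matrix.J (Fin 2) ℂ = fromBlocks 0 (-1) 1 0 := rfl
  rw [hJ, fromBlocks_conjTranspose, fromBlocks_multiply, fromBlocks_multiply] at hx
  simp only [conjTranspose_zero, Matrix.zero_mul, Matrix.mul_zero, zero_add, add_zero, Matrix.mul_neg, Matrix.mul_one, Matrix.neg_mul] at hx
  obtain ⟨-, h12, h21, -⟩ := fromBlocks_inj.1 hx
  exact ⟨h12, by rw [conjTranspose_neg, Matrix.neg_mul]; exact h21⟩

/-- `(0 B; C 0) = J · diag(C, −B)`. [Shimura1997, §5] -/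
theorem antidiag_eq_J_mul_levi (B C : Matrix (Fin 2) (Fin 2) ℂ) :
    (fromBlocks 0 B C 0 : Matrix (Fin 2 ⊕ Fin 2) (Fin 2 ⊕ Fin 2) ℂ) = Matrix.J (Fin 2) ℂ * fromBlocks C 0 0 (-B) := by
  have hJ : Matrix.J (Fin 2) ℂ = fromBlocks 0 (-1) 1 0 := rfl
  rw [hJ, fromBlocks_multiply]
  simp

/-- `diag(C, −B) · n(b) = n(C b Cᴴ) · diag(C, −B)` when `Cᴴ B = −1`. [Shimura1997, §5] -/
theorem levi_mul_transl {B C : Matrix (Fin 2) (Fin 2) ℂ} (hCB : Cᴴ * B = -1) (b : Matrix (Fin 2) (Fin 2) ℂ) :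
    (fromBlocks C 0 0 (-B) : Matrix (Fin 2 ⊕ Fin 2) (Fin 2 ⊕ Fin 2) ℂ) * fromBlocks 1 b 0 1 = fromBlocks 1 (C * b * Cᴴ) 0 1 * fromBlocks C 0 0 (-B) := by
  rw [fromBlocks_multiply, fromBlocks_multiply]
  have h : C * b * Cᴴ * (-B) = C * b := by
    rw [Matrix.mul_neg, Matrix.mul_assoc (C * b), hCB, Matrix.mul_neg, Matrix.mul_one, neg_neg]
  simp [h]

/-! ## §2  The block integral in the frame's coordinates -/

/-- **`∫_{Herm₂} F(x·n(b)·g) db = ‖det C‖⁻⁴ · M_w F (m g)`** for `x = (0 B; C 0) ∈ U(J)`, `m = diag(C, −B)`, ANY `F`, ANY `g` (chart `hermOfReal`; ★ `integral_hermOfReal_eq`,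
★ `integral_comp_hermTwo_conj`). [Shimura1997, §16.4] -/
theorem integral_antidiag_transl {B C : Matrix (Fin 2) (Fin 2) ℂ} (hx : (fromBlocks 0 B C 0 : Matrix (Fin 2 ⊕ Fin 2) (Fin 2 ⊕ Fin 2) ℂ)ᴴ * Matrix.J (Fin 2) ℂ * (fromBlocks 0 B C 0 : Matrix (Fin 2 ⊕ Fin 2) (Fin 2 ⊕ Fin 2) ℂ) = Matrix.J (Fin 2) ℂ)
    (F : Matrix (Fin 2 ⊕ Fin 2) (Fin 2 ⊕ Fin 2) ℂ → ℂ) (g : Matrix (Fin 2 ⊕ Fin 2) (Fin 2 ⊕ Fin 2) ℂ) :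
    ∫ r : Fin 2 → Fin 2 → ℝ, F ((fromBlocks 0 B C 0 : Matrix (Fin 2 ⊕ Fin 2) (Fin 2 ⊕ Fin 2) ℂ) * fromBlocks 1 (hermOfReal r) 0 1 * g) =
      (((‖C.det‖ : ℝ) : ℂ) ^ 4)⁻¹ * archIntertwining F (fromBlocks C 0 0 (-B) * g) := by
  obtain ⟨hCB, hBC⟩ := antidiag_letters hx
  have hC : C.det ≠ 0 := (Matrix.isUnit_det_of_left_inverse hBC).ne_zero
  have hn : (((‖C.det‖ : ℝ) : ℂ) ^ 4) ≠ 0 := pow_ne_zero _ (by exact_mod_cast (norm_pos_iff.2 hC).ne')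
  have e1 : ∀ X : Matrix (Fin 2) (Fin 2) ℂ, (fromBlocks 0 B C 0 : Matrix (Fin 2 ⊕ Fin 2) (Fin 2 ⊕ Fin 2) ℂ) * fromBlocks 1 X 0 1 * g =
      Matrix.J (Fin 2) ℂ * fromBlocks 1 (C * X * Cᴴ) 0 1 * (fromBlocks C 0 0 (-B) * g) := by
    intro X
    rw [antidiag_eq_J_mul_levi, Matrix.mul_assoc (Matrix.J (Fin 2) ℂ), levi_mul_transl hCB, ← Matrix.mul_assoc (Matrix.J (Fin 2) ℂ), Matrix.mul_assoc _ _ g]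
  simp only [e1]
  rw [archIntertwining_apply, integral_hermOfReal_eq (fun X => F (Matrix.J (Fin 2) ℂ * fromBlocks 1 (C * X * Cᴴ) 0 1 * (fromBlocks C 0 0 (-B) * g))),
    integral_hermOfReal_eq (fun X => F (Matrix.J (Fin 2) ℂ * fromBlocks 1 X 0 1 * (fromBlocks C 0 0 (-B) * g))),
    integral_comp_hermTwo_conj hC (fun X => F (Matrix.J (Fin 2) ℂ * fromBlocks 1 X 0 1 * (fromBlocks C 0 0 (-B) * g))), Complex.real_smul]
  push_cast
  field_simp

/-! ## §3  One place: holomorphy -/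

/-- **THE ARCH BLOCK AT ONE COMPLEX PLACE IS HOLOMORPHIC ON `{0 < re}`** (odd `k`): for `x = (0 B; C 0) ∈ U(J)` (the frame image of `w_Δ`), `g ∈ U(J)` (of `κ_w`) and a compact
picture `Q`, there is `E` holomorphic on `{0 < re s}` with `∫_{Herm₂} F(x·n(b)·g) db = E(s)` for EVERY `F ∈ I_w(s,χ_k)` with `cp F = Q`, at every `s` with `re s > ½` (§2 + ★ FILE 9 at `m g`).
[Shimura1982, (1.31)] [KudlaRallis1994, §1] [Tan1999, §3] -/
theorem archBlock_continuation {k : ℤ} (hk : Odd k) (Q : Carrier) {B C : Matrix (Fin 2) (Fin 2) ℂ} (hx : (fromBlocks 0 B C 0 : Matrix (Fin 2 ⊕ Fin 2) (Fin 2 ⊕ Fin 2) ℂ)ᴴ * Matrix.J (Fin 2) ℂ * (fromBlocks 0 B C 0 : Matrix (Fin 2 ⊕ Fin 2) (Fin 2 ⊕ Fin 2) ℂ) = Matrix.J (Fin 2) ℂ)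
    {g : Matrix (Fin 2 ⊕ Fin 2) (Fin 2 ⊕ Fin 2) ℂ} (hg : gᴴ * Matrix.J (Fin 2) ℂ * g = Matrix.J (Fin 2) ℂ) :
    ∃ E : ℂ → ℂ, DifferentiableOn ℂ E {s : ℂ | 0 < s.re} ∧ ∀ s : ℂ, 1 / 2 < s.re →
      (∃ F : Matrix (Fin 2 ⊕ Fin 2) (Fin 2 ⊕ Fin 2) ℂ → ℂ, IsArchSiegelSection (fun z : ℂ => (conj z / ((‖z‖ : ℝ) : ℂ)) ^ k) s F ∧
        (∀ (v : Matrix (Fin 2) (Fin 2) ℂ), vᴴ * v = 1 → ∀ hv : v.det ≠ 0, F ((2 : ℂ)⁻¹ • fromBlocks (1 + v) (-(I • (1 - v))) (I • (1 - v)) (1 + v) : Matrix (Fin 2 ⊕ Fin 2) (Fin 2 ⊕ Fin 2) ℂ) = evalAt v hv Q)) ∧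
      (∀ F : Matrix (Fin 2 ⊕ Fin 2) (Fin 2 ⊕ Fin 2) ℂ → ℂ, IsArchSiegelSection (fun z : ℂ => (conj z / ((‖z‖ : ℝ) : ℂ)) ^ k) s F →
        (∀ (v : Matrix (Fin 2) (Fin 2) ℂ), vᴴ * v = 1 → ∀ hv : v.det ≠ 0, F ((2 : ℂ)⁻¹ • fromBlocks (1 + v) (-(I • (1 - v))) (I • (1 - v)) (1 + v) : Matrix (Fin 2 ⊕ Fin 2) (Fin 2 ⊕ Fin 2) ℂ) = evalAt v hv Q) →
        ∫ r : Fin 2 → Fin 2 → ℝ, F ((fromBlocks 0 B C 0 : Matrix (Fin 2 ⊕ Fin 2) (Fin 2 ⊕ Fin 2) ℂ) * fromBlocks 1 (hermOfReal r) 0 1 * g) = E s) := by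
  obtain ⟨-, hBC⟩ := antidiag_letters hx
  obtain ⟨E, hE, h⟩ := kFinite_continuation hk Q (mul_mem_UJ (levi_mem hBC) hg)
  refine ⟨fun s => (((‖C.det‖ : ℝ) : ℂ) ^ 4)⁻¹ * E s, (differentiableOn_const _).mul hE, fun s hs => ⟨(h s hs).1, fun F hF hFQ => ?_⟩⟩
  rw [integral_antidiag_transl hx F g, (h s hs).2 F hF hFQ]

/-! ## §4  Finitely many places: the product -/

/-- **(E8) MULTI-PLACE IN THE FRAME'S COORDINATES**: over a finite set `σ` of complex places with anti-diagonal `x_w = (0 B_w; C_w 0) ∈ U(J)`, points `g_w ∈ U(J)`, odd weights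
`k_w` and compact pictures `Q_w`, there is `E` holomorphic on `{0 < re s}` with
`∫_{∏_w Herm₂} ∏_w F_w(x_w·n(b_w)·g_w) db = E(s)` for EVERY family of sections `F_w ∈ I_w(s,χ_{k_w})` with `cp F_w = Q_w`, at every `s` with `re s > ½`
(§3 place by place, Mathlib `integral_fintype_prod_volume_eq_prod`, ★ (H1) `differentiableOn_finset_prod`). [KudlaRallis1994, §1] [Tan1999, §3] -/
theorem archBlock_prod_continuation {σ : Type*} [Fintype σ] (k : σ → ℤ) (hk : ∀ w, Odd (k w)) (Q : σ → Carrier)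
    (B C : σ → Matrix (Fin 2) (Fin 2) ℂ) (hx : ∀ w, (fromBlocks 0 (B w) (C w) 0 : Matrix (Fin 2 ⊕ Fin 2) (Fin 2 ⊕ Fin 2) ℂ)ᴴ * Matrix.J (Fin 2) ℂ * (fromBlocks 0 (B w) (C w) 0 : Matrix (Fin 2 ⊕ Fin 2) (Fin 2 ⊕ Fin 2) ℂ) = Matrix.J (Fin 2) ℂ)
    (g : σ → Matrix (Fin 2 ⊕ Fin 2) (Fin 2 ⊕ Fin 2) ℂ) (hg : ∀ w, (g w)ᴴ * Matrix.J (Fin 2) ℂ * (g w) = Matrix.J (Fin 2) ℂ) :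
    ∃ E : ℂ → ℂ, DifferentiableOn ℂ E {s : ℂ | 0 < s.re} ∧ ∀ s : ℂ, 1 / 2 < s.re →
      ∀ F : σ → Matrix (Fin 2 ⊕ Fin 2) (Fin 2 ⊕ Fin 2) ℂ → ℂ, (∀ w, IsArchSiegelSection (fun z : ℂ => (conj z / ((‖z‖ : ℝ) : ℂ)) ^ (k w)) s (F w)) →
        (∀ w, ∀ (v : Matrix (Fin 2) (Fin 2) ℂ), vᴴ * v = 1 → ∀ hv : v.det ≠ 0, (F w) ((2 : ℂ)⁻¹ • fromBlocks (1 + v) (-(I • (1 - v))) (I • (1 - v)) (1 + v) : Matrix (Fin 2 ⊕ Fin 2) (Fin 2 ⊕ Fin 2) ℂ) = evalAt v hv (Q w)) →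
        ∫ r : σ → (Fin 2 → Fin 2 → ℝ), ∏ w, F w ((fromBlocks 0 (B w) (C w) 0 : Matrix (Fin 2 ⊕ Fin 2) (Fin 2 ⊕ Fin 2) ℂ) * fromBlocks 1 (hermOfReal (r w)) 0 1 * g w) = E s := by
  choose E hE hEq using fun w => archBlock_continuation (hk w) (Q w) (hx w) (hg w)
  refine ⟨fun s => ∏ w, E w s, differentiableOn_finset_prod _ _ _ fun w _ => hE w, fun s hs F hF hFQ => ?_⟩
  rw [integral_fintype_prod_volume_eq_prod (fun w (r : Fin 2 → Fin 2 → ℝ) => F w ((fromBlocks 0 (B w) (C w) 0 : Matrix (Fin 2 ⊕ Fin 2) (Fin 2 ⊕ Fin 2) ℂ) * fromBlocks 1 (hermOfReal r) 0 1 * g w))]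
  exact Finset.prod_congr rfl fun w _ => ((hEq w s hs).2 (F w) (hF w) (hFQ w))

end Summit.HodgeConjecture.HodgeConjecture.Cruxes.HLiu418.K2LiuArchBlockOfFrame

end
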